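/-
Copyright (c) 2026 the pub-hodgecm-mathlib formalisation cell (harness21).  Prover seat hodgecm-mathlib-F0P3a-p02 (g17): road «S3-ram» (junction pen F0P3a-p01 (g17),
J-PACK v2 (f) isoceles wave, sockets S45), organ G3⁶ «THE RESIDUAL EIGENFRAME OF AN ISOCELES LITERAL»; 2026-09-02.
-/
import Literature.NumberTheory.Automorphic.UnitaryLatticeTreeResidualDatumRamified   -- ★ G3⁵ p847483 (F0P2-p06): integral leading terms, residue dictionary; brings ★ G3⁗ root bridge
import HarnessLib

/-!
# The lattice graph of a hermitian space — THE RESIDUAL EIGENFRAME of a residually semisimple fixed element at a tamely ramified place: `Ȳ = Ā·diag(ȳ)·Ā⁻¹` with a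
# DIAGONAL residual Gram `ᵗĀJ̄₀Ā = diag(δ)`, and the root-plane hyperbolicity dictionary (Bruhat–Tits 1972 §10; Kottwitz 1986 §3; Rogawski 1990 §4.9)

Topic `NumberTheory/Automorphic`; namespace `Literature.NumberTheory.Automorphic.UnitaryLatticeTree`.  THEOREMS ONLY (no definition, no instance, no notation, no named fact,
no `sorry`); kernel lane `--supports stmt-HodgeConjecture-24833`.  Cell `pub/hodgecm-mathlib` (D-0151), crux H413; road «S3-ram» (Literature seeding, count-neutral); junction
J-PACK v2 (F0P3a-p01 (g17)) iso sockets S45 (hand F0P3a-p02 (g17)).  Part **G3⁶**, the SEMISIMPLE twin of ★ G3⁵ `UnitaryLatticeTreeResidualDatumRamified` (F0P2-p06): there the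
residual matrix `Ȳ = ϖ^{−d}(γ′ − 1) mod ϖ` of a vertex OFF the root region is nilpotent; here, AT THE ROOT of an isoceles literal `γ = A·diag(s)·A⁻¹` (the junction's eigen-data:
`A ∈ GL₃(𝒪)` with `J₀`-orthogonal columns, `diag(d) = (−det diag d)·ᵗσ(A)J₀A`, unit norms `d`, isolated index `i₀`, `|s_{i₀} − s_j| = |ϖ|^{d₀}`, `|s_j − s_l| ≤ |ϖ|^{d₀+2}` on
the close pair, `|s_m − 1| ≤ |ϖ|^{d₀}`), it is SEMISIMPLE: with `Ā := A mod ϖ ∈ GL₃(𝓀)` and `ȳ_m := ((s_m − 1)∕ϖ^{d₀}) mod ϖ`,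
  **`Y₀ := (ϖ^{d₀})⁻¹(γ − 1) ∈ M₃(𝒪)`, `Ā⁻¹·Ȳ·Ā = diag(ȳ)`, `ᵗĀ·J̄₀·Ā = diag(δ)` (`δ_m = d̄_m∕(−d̄₀d̄₁d̄₂) ≠ 0`), `ȳ_j = ȳ_l ≠ ȳ_{i₀}`**,
and the ROOT PLANE `ū_{i₀}^⊥ = ⟨ū_j, ū_l⟩` is residually hyperbolic — `∃ t, |t| = 1 ∧ |d_j + tσ(t)d_l| < 1` (the junction's `hhyp` in F0P3-p03 (g15)'s ★ spelling p847753) — **iff `χ(−δ_jδ_l) = 1`**.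
This is exactly the input `(M, Y₀, hY₀)` of the ★ root bridge `ncard_neighborSet_root_pred_eq_natCard` (G3⁗) and the input `(Ā, Ȳ, hG, hY, δ, y)` of the ROOT CENSUS
★ `Rogawski1990/DepthZeroKappaTransferTypeOneRamifiedIsocelesRootCensus` (this seat), whose product is the junction's ROOT LINE CENSUS `(2, q−1, 0)` ∕ `(0, q+1, 0)`.
* §1 `exists_residualGL_of_isIntMatrix` (an integral `A ∈ GL₃(K)` with integral inverse reduces to `Ā ∈ GL₃(𝓀)`), `StdForm.over_map'` (`J₀` commutes with ring maps);
* §2 **`exists_residualEigenframe_of_isoceles`** (the statement above, one `∃`); §3 (ED. 2) `exists_residualEigenframe_of_isoceles'` — the same with `δ`, `y` PINNED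
  (`δ_m = red(d_m∕(−det diag d))`, `y_m = red((s_m−1)∕ϖ^{d₀})`) for consumers that name the census class by a `K`-level constant (S45 `lock`∕`BIG`).
HONEST LABEL: HC_CM is proved only modulo the 2 remaining named inputs (hLiu418 24832, h413 24833) until rung 0 closes; nothing printed is asserted here (residual bookkeeping).

## References
* [BruhatTits1972] F. Bruhat, J. Tits, *Groupes réductifs sur un corps local I*, Publ. Math. IHÉS 41 (1972), §10 (reduction of vertex stabilisers).
* [Kottwitz1986] R. E. Kottwitz, *Base change for unit elements of Hecke algebras*, Compositio Math. 60 (1986), §3 (the residual datum of a fixed lattice).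
* [Rogawski1990] J. D. Rogawski, *Automorphic Representations of Unitary Groups in Three Variables*, Ann. of Math. Stud. 123 (1990), §4.9 (the three configurations).
* [Serre1980Trees] J.-P. Serre, *Trees* (1980), Ch. II §1.1 (lattices, frames, reduction).
-/

set_option autoImplicit false

noncomputable section

open scoped Valued WithZero Matrix MatrixGroups

namespace Literature.NumberTheory.Automorphic.UnitaryLatticeTree

open Literature.NumberTheory.Automorphic Literature.NumberTheory.Automorphic.HermitianLattice
open Literature.NumberTheory.Automorphic.CartanUnique Literature.NumberTheory.Automorphic.UnitaryGroup
open Matrix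

variable {K : Type*} [Field K] [Valued K ℤᵐ⁰] {σ : K →+* K} {ϖ : K}

/-! ## §1 Integral matrices reduce -/

omit [Valued K ℤᵐ⁰] in
/-- `J₀` commutes with ring maps: `(J₀ over R).map f = J₀ over R'` (its entries are `0, 1`). [cite: Rogawski1990, §1.9] -/
theorem StdForm.over_map' {R R' : Type*} [Ring R] [Ring R'] (f : R →+* R') (N : ℕ) :
    ((StdForm.antidiagonal N).over R).map f = (StdForm.antidiagonal N).over R' := by
  rw [StdForm.over, StdForm.over, Matrix.map_map]
  congr 1
  funext n
  simp

/-- **INTEGRAL `GL₃` REDUCES**: an `A ∈ GL₃(K)` with `A` and `A⁻¹` integral is the image of an `𝒪`-matrix pair `AO·AO' = AO'·AO = 1`, whose residues form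
`Ā ∈ GL₃(𝓀)` with `Ā⁻¹ = AO' mod ϖ`. [cite: Serre1980Trees, II.1.1] [cite: BruhatTits1972, §10] -/
theorem exists_residualGL_of_isIntMatrix (A : GL (Fin 3) K) (hA : IsIntMatrix (A : Matrix (Fin 3) (Fin 3) K))
    (hA' : IsIntMatrix ((A⁻¹ : GL (Fin 3) K) : Matrix (Fin 3) (Fin 3) K)) :
    ∃ (AO AO' : Matrix (Fin 3) (Fin 3) 𝒪[K]) (Ab : GL (Fin 3) 𝓀[K]),
      AO.map (Valued.integer K).subtype = (A : Matrix (Fin 3) (Fin 3) K) ∧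
      AO'.map (Valued.integer K).subtype = ((A⁻¹ : GL (Fin 3) K) : Matrix (Fin 3) (Fin 3) K) ∧
      AO * AO' = 1 ∧ AO' * AO = 1 ∧
      (Ab : Matrix (Fin 3) (Fin 3) 𝓀[K]) = AO.map (IsLocalRing.residue 𝒪[K]) ∧
      ((Ab⁻¹ : GL (Fin 3) 𝓀[K]) : Matrix (Fin 3) (Fin 3) 𝓀[K]) = AO'.map (IsLocalRing.residue 𝒪[K]) := by
  set AO : Matrix (Fin 3) (Fin 3) 𝒪[K] := Matrix.of fun i j => (⟨(A : Matrix (Fin 3) (Fin 3) K) i j, hA i j⟩ : 𝒪[K]) with hAO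
  set AO' : Matrix (Fin 3) (Fin 3) 𝒪[K] := Matrix.of fun i j => (⟨((A⁻¹ : GL (Fin 3) K) : Matrix (Fin 3) (Fin 3) K) i j, hA' i j⟩ : 𝒪[K]) with hAO'
  have hmA : AO.map (Valued.integer K).subtype = (A : Matrix (Fin 3) (Fin 3) K) := by ext i j; rfl
  have hmA' : AO'.map (Valued.integer K).subtype = ((A⁻¹ : GL (Fin 3) K) : Matrix (Fin 3) (Fin 3) K) := by ext i j; rfl
  have hinj : Function.Injective (fun M : Matrix (Fin 3) (Fin 3) 𝒪[K] => M.map (Valued.integer K).subtype) :=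
    Matrix.map_injective Subtype.coe_injective
  have h1 : AO * AO' = 1 := hinj (by
    dsimp only
    rw [Matrix.map_mul, hmA, hmA', ← Units.val_mul, mul_inv_cancel, Units.val_one, Matrix.map_one _ (map_zero _) (map_one _)])
  have h2 : AO' * AO = 1 := hinj (by
    dsimp only
    rw [Matrix.map_mul, hmA, hmA', ← Units.val_mul, inv_mul_cancel, Units.val_one, Matrix.map_one _ (map_zero _) (map_one _)])
  have h1' : AO.map (IsLocalRing.residue 𝒪[K]) * AO'.map (IsLocalRing.residue 𝒪[K]) = 1 := by
    rw [← Matrix.map_mul, h1, Matrix.map_one _ (map_zero _) (map_one _)]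
  have h2' : AO'.map (IsLocalRing.residue 𝒪[K]) * AO.map (IsLocalRing.residue 𝒪[K]) = 1 := by
    rw [← Matrix.map_mul, h2, Matrix.map_one _ (map_zero _) (map_one _)]
  exact ⟨AO, AO', ⟨AO.map (IsLocalRing.residue 𝒪[K]), AO'.map (IsLocalRing.residue 𝒪[K]), h1', h2'⟩, hmA, hmA', h1, h2, rfl, rfl⟩

omit [Valued K ℤᵐ⁰] in
/-- Non-zero squares do not change square classes: `IsSquare (u·u·a) ↔ IsSquare a` (`u ≠ 0`). [cite: IrelandRosen1990, Ch. 8 §1] -/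
theorem isSquare_mul_self_mul_iff' {F : Type*} [Field F] {u : F} (hu : u ≠ 0) (a : F) : IsSquare (u * u * a) ↔ IsSquare a := by
  constructor
  · rintro ⟨r, hr⟩
    exact ⟨r / u, by field_simp; linear_combination hr⟩
  · rintro ⟨r, hr⟩
    exact ⟨u * r, by rw [hr]; ring⟩

/-! ## §2 The residual eigenframe -/

/-- **THE RESIDUAL EIGENFRAME OF AN ISOCELES LITERAL.**  For the junction's eigen-data — `A ∈ GL₃(K)` integral with integral inverse, `diag(d) = (−det diag d)·ᵗσ(A)·J₀·A`
with unit `d`, `γ = A·diag(s)·A⁻¹`, `|s_m − 1| ≤ |ϖ|^{d₀}`, isolated index `i₀` (`|s_{i₀} − s_j| = |ϖ|^{d₀}` for `j ≠ i₀`), close pair `|s_j − s_l| ≤ |ϖ|^{d₀+2}` — there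
are `Ā ∈ GL₃(𝓀)`, an integral `Y₀ = (ϖ^{d₀})⁻¹(γ − 1)`, and `δ, y : Fin 3 → 𝓀` with: `ᵗĀ·J̄₀·Ā = diag(δ)`, all `δ_m ≠ 0`; `Ā⁻¹·Ȳ·Ā = diag(y)` (`Ȳ = Y₀ mod ϖ`); `y_j = y_l` on
the close pair and `y_{i₀} ≠ y_j`; and the ROOT-PLANE DICTIONARY `(∃ t, |t| = 1 ∧ |d_j + tσ(t)d_l| < 1) ↔ χ(−δ_jδ_l) = 1` (F0P3-p03's ★ token p847753).  (`σ` valuation-preserving and residually trivial.)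
[cite: Kottwitz1986, §3] [cite: BruhatTits1972, §10] [cite: Rogawski1990, §4.9 p. 55] -/
theorem exists_residualEigenframe_of_isoceles (hvσ : ∀ a, Valued.v (σ a) = Valued.v a) (hres : ∀ x : K, Valued.v x ≤ 1 → Valued.v (σ x - x) < 1)
    (hϖ : Valued.v ϖ = WithZero.exp (-1 : ℤ)) [Fintype 𝓀[K]] [DecidableEq 𝓀[K]]
    {γ : unitaryGroupOfForm σ ((StdForm.antidiagonal 3).over K)}
    (d : Fin 3 → K) (hd : ∀ i, Valued.v (d i) = 1)
    (A : GL (Fin 3) K) (hA : IsIntMatrix (A : Matrix (Fin 3) (Fin 3) K)) (hA' : IsIntMatrix ((A⁻¹ : GL (Fin 3) K) : Matrix (Fin 3) (Fin 3) K))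
    (hdA : Matrix.diagonal d = (-(Matrix.diagonal d).det) • formCongr σ A ((StdForm.antidiagonal 3).over K))
    (s : Fin 3 → K)
    (hγA : ((γ : GL (Fin 3) K) : Matrix (Fin 3) (Fin 3) K) = (A : Matrix (Fin 3) (Fin 3) K) * Matrix.diagonal s * ((A⁻¹ : GL (Fin 3) K) : Matrix (Fin 3) (Fin 3) K))
    (i₀ : Fin 3) {d₀ : ℕ} (he : ∀ i, Valued.v (s i - 1) ≤ Valued.v ϖ ^ d₀)
    (hiso : ∀ j, j ≠ i₀ → Valued.v (s i₀ - s j) = Valued.v ϖ ^ d₀) (hclose : ∀ j k, j ≠ i₀ → k ≠ i₀ → Valued.v (s j - s k) ≤ Valued.v ϖ ^ (d₀ + 2)) :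
    ∃ (Ab : GL (Fin 3) 𝓀[K]) (Y₀ : Matrix (Fin 3) (Fin 3) 𝒪[K]) (δ y : Fin 3 → 𝓀[K]),
      (∀ i j, ((Y₀ i j : 𝒪[K]) : K) = (ϖ ^ d₀)⁻¹ * ((((γ : GL (Fin 3) K) : Matrix (Fin 3) (Fin 3) K) - 1) i j)) ∧
      ((Ab : Matrix (Fin 3) (Fin 3) 𝓀[K]))ᵀ * ((StdForm.antidiagonal 3).over 𝓀[K]) * (Ab : Matrix (Fin 3) (Fin 3) 𝓀[K]) = Matrix.diagonal δ ∧
      (∀ m, δ m ≠ 0) ∧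
      ((Ab⁻¹ : GL (Fin 3) 𝓀[K]) : Matrix (Fin 3) (Fin 3) 𝓀[K]) * Y₀.map (IsLocalRing.residue 𝒪[K]) * (Ab : Matrix (Fin 3) (Fin 3) 𝓀[K]) = Matrix.diagonal y ∧
      (∀ j l, j ≠ i₀ → l ≠ i₀ → y j = y l) ∧ (∀ j, j ≠ i₀ → y i₀ ≠ y j) ∧
      (∀ j l, j ≠ i₀ → l ≠ i₀ → j ≠ l →
        ((∃ t : K, Valued.v t = 1 ∧ Valued.v (d j + t * σ t * d l) < 1) ↔ quadraticChar 𝓀[K] (-(δ j * δ l)) = 1)) := by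
  have hϖ0 : ϖ ≠ 0 := uniformizer_ne_zero hϖ
  have hvϖ0 : Valued.v ϖ ≠ 0 := (Valuation.ne_zero_iff _).2 hϖ0
  have hvd0 : Valued.v ϖ ^ d₀ ≠ 0 := pow_ne_zero _ hvϖ0
  have hlt1 : ∀ z : K, Valued.v z < 1 ↔ Valued.v z ≤ Valued.v ϖ := fun z => by rw [hϖ]; exact v_lt_one_iff z
  have hϖlt1 : Valued.v ϖ < 1 := (hlt1 ϖ).2 le_rfl
  have hres0 : ∀ x : 𝒪[K], IsLocalRing.residue 𝒪[K] x = 0 ↔ Valued.v (x : K) < 1 := residue_eq_zero_iff_v_lt_one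
  obtain ⟨AO, AO', Ab, hmA, hmA', h1, h2, hAb, hAb'⟩ := exists_residualGL_of_isIntMatrix A hA hA'
  have hinj : Function.Injective (fun M : Matrix (Fin 3) (Fin 3) 𝒪[K] => M.map (Valued.integer K).subtype) :=
    Matrix.map_injective Subtype.coe_injective
  -- residual inverse pair
  have hAb1 : (Ab : Matrix (Fin 3) (Fin 3) 𝓀[K]) * ((Ab⁻¹ : GL (Fin 3) 𝓀[K]) : Matrix (Fin 3) (Fin 3) 𝓀[K]) = 1 := by
    rw [← Units.val_mul, mul_inv_cancel, Units.val_one]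
  have hAb2 : ((Ab⁻¹ : GL (Fin 3) 𝓀[K]) : Matrix (Fin 3) (Fin 3) 𝓀[K]) * (Ab : Matrix (Fin 3) (Fin 3) 𝓀[K]) = 1 := by
    rw [← Units.val_mul, inv_mul_cancel, Units.val_one]
  -- ### the integral eigenvalue leading terms `t m = (ϖ^{d₀})⁻¹ (s m − 1)`
  have ht : ∀ m, (ϖ ^ d₀)⁻¹ * (s m - 1) ∈ 𝒪[K] := fun m => by
    refine (Valuation.mem_integer_iff _ _).2 ?_
    rw [map_mul, map_inv₀, map_pow]
    have h' := mul_le_mul' (le_refl ((Valued.v ϖ ^ d₀)⁻¹)) (he m)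
    rwa [inv_mul_cancel₀ hvd0] at h'
  set tO : Fin 3 → 𝒪[K] := fun m => ⟨(ϖ ^ d₀)⁻¹ * (s m - 1), ht m⟩ with htO
  set Y₀ : Matrix (Fin 3) (Fin 3) 𝒪[K] := AO * Matrix.diagonal tO * AO' with hY₀def
  have hAA : (A : Matrix (Fin 3) (Fin 3) K) * ((A⁻¹ : GL (Fin 3) K) : Matrix (Fin 3) (Fin 3) K) = 1 := by
    rw [← Units.val_mul, mul_inv_cancel, Units.val_one]
  have hY₀map : Y₀.map (Valued.integer K).subtype = (ϖ ^ d₀)⁻¹ • ((((γ : GL (Fin 3) K) : Matrix (Fin 3) (Fin 3) K) - 1)) := by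
    rw [hY₀def, Matrix.map_mul, Matrix.map_mul, hmA, hmA', Matrix.diagonal_map (map_zero _)]
    have hdiag : Matrix.diagonal (fun m => (Valued.integer K).subtype (tO m)) = (ϖ ^ d₀)⁻¹ • Matrix.diagonal (s - 1) := by
      rw [← Matrix.diagonal_smul]; rfl
    have hds : Matrix.diagonal (s - 1) = Matrix.diagonal s - 1 := by
      rw [← Matrix.diagonal_one, Matrix.diagonal_sub]; rfl
    rw [hdiag, Matrix.mul_smul, Matrix.smul_mul, hγA, hds, Matrix.mul_sub, Matrix.sub_mul, Matrix.mul_one, hAA]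
  have hY₀ : ∀ i j, ((Y₀ i j : 𝒪[K]) : K) = (ϖ ^ d₀)⁻¹ * ((((γ : GL (Fin 3) K) : Matrix (Fin 3) (Fin 3) K) - 1) i j) := fun i j => by
    have h := congrFun (congrFun hY₀map i) j
    rw [Matrix.map_apply, Matrix.smul_apply, smul_eq_mul] at h
    exact h
  -- ### the residual Gram: `diag(d) = c • ᵗσ(A) J₀ A` integrally, then mod ϖ with `σ̄ = id`
  set c : K := -(Matrix.diagonal d).det with hc
  have hcv : Valued.v c = 1 := by
    rw [hc, Valuation.map_neg, Matrix.det_diagonal, map_prod]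
    exact Finset.prod_eq_one fun i _ => hd i
  have hcO : c ∈ 𝒪[K] := (Valuation.mem_integer_iff _ _).2 hcv.le
  set AσO : Matrix (Fin 3) (Fin 3) 𝒪[K] := Matrix.of fun i j => (⟨σ ((AO i j : 𝒪[K]) : K), map_coe_mem_integer hvσ (AO i j)⟩ : 𝒪[K]) with hAσO
  have hmAσ : AσO.map (Valued.integer K).subtype = ((A : Matrix (Fin 3) (Fin 3) K)).map σ := by
    ext i j
    rw [← hmA]
    rfl
  set dO : Fin 3 → 𝒪[K] := fun m => ⟨d m, (Valuation.mem_integer_iff _ _).2 (hd m).le⟩ with hdO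
  -- the integral identity `diag(dO) = diag(c) * (ᵗAσO * J₀O * AO)`
  have hint : Matrix.diagonal dO = Matrix.diagonal (fun _ => (⟨c, hcO⟩ : 𝒪[K])) * ((AσO)ᵀ * ((StdForm.antidiagonal 3).over 𝒪[K]) * AO) := hinj (by
    dsimp only
    rw [Matrix.map_mul, Matrix.map_mul, Matrix.map_mul, Matrix.diagonal_map (map_zero _), Matrix.diagonal_map (map_zero _), Matrix.transpose_map, hmAσ, hmA,
      StdForm.over_map', ← Matrix.smul_eq_diagonal_mul]
    exact hdA)
  -- mod ϖ: `σ̄ = id` on residues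
  have hAσres : AσO.map (IsLocalRing.residue 𝒪[K]) = AO.map (IsLocalRing.residue 𝒪[K]) := by
    ext i j
    rw [Matrix.map_apply, Matrix.map_apply, hAσO, Matrix.of_apply]
    exact residue_map_sigma_eq hvσ hres (AO i j)
  set cb : 𝓀[K] := IsLocalRing.residue 𝒪[K] ⟨c, hcO⟩ with hcb
  have hcb0 : cb ≠ 0 := by
    rw [hcb, Ne, hres0]; exact fun h => absurd hcv (ne_of_lt h)
  set δ : Fin 3 → 𝓀[K] := fun m => cb⁻¹ * IsLocalRing.residue 𝒪[K] (dO m) with hδ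
  have hdres0 : ∀ m, IsLocalRing.residue 𝒪[K] (dO m) ≠ 0 := fun m => by
    rw [Ne, hres0]; exact fun h => absurd (hd m) (ne_of_lt h)
  have hδ0 : ∀ m, δ m ≠ 0 := fun m => mul_ne_zero (inv_ne_zero hcb0) (hdres0 m)
  have hres' : Matrix.diagonal (fun m => IsLocalRing.residue 𝒪[K] (dO m)) =
      Matrix.diagonal (fun _ : Fin 3 => cb) * ((AO.map (IsLocalRing.residue 𝒪[K]))ᵀ * ((StdForm.antidiagonal 3).over 𝓀[K]) * AO.map (IsLocalRing.residue 𝒪[K])) := by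
    have h := congrArg (fun M : Matrix (Fin 3) (Fin 3) 𝒪[K] => M.map (IsLocalRing.residue 𝒪[K])) hint
    simpa only [Matrix.map_mul, Matrix.diagonal_map (map_zero _), Matrix.transpose_map, hAσres, StdForm.over_map'] using h
  have hG : ((Ab : Matrix (Fin 3) (Fin 3) 𝓀[K]))ᵀ * ((StdForm.antidiagonal 3).over 𝓀[K]) * (Ab : Matrix (Fin 3) (Fin 3) 𝓀[K]) = Matrix.diagonal δ := by
    have hone : Matrix.diagonal (fun _ : Fin 3 => cb⁻¹) * Matrix.diagonal (fun _ : Fin 3 => cb) = 1 := by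
      rw [Matrix.diagonal_mul_diagonal, ← Matrix.diagonal_one]
      exact congrArg Matrix.diagonal (funext fun _ => inv_mul_cancel₀ hcb0)
    rw [hAb]
    calc (AO.map (IsLocalRing.residue 𝒪[K]))ᵀ * ((StdForm.antidiagonal 3).over 𝓀[K]) * AO.map (IsLocalRing.residue 𝒪[K])
        = Matrix.diagonal (fun _ : Fin 3 => cb⁻¹) * (Matrix.diagonal (fun _ : Fin 3 => cb) *
            ((AO.map (IsLocalRing.residue 𝒪[K]))ᵀ * ((StdForm.antidiagonal 3).over 𝓀[K]) * AO.map (IsLocalRing.residue 𝒪[K]))) := by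
          rw [← Matrix.mul_assoc, hone, Matrix.one_mul]
      _ = Matrix.diagonal (fun _ : Fin 3 => cb⁻¹) * Matrix.diagonal (fun m => IsLocalRing.residue 𝒪[K] (dO m)) := by rw [← hres']
      _ = Matrix.diagonal δ := by rw [Matrix.diagonal_mul_diagonal]
  -- ### `Ȳ = Ā diag(ȳ) Ā'`
  set y : Fin 3 → 𝓀[K] := fun m => IsLocalRing.residue 𝒪[K] (tO m) with hy
  have hYbar : Y₀.map (IsLocalRing.residue 𝒪[K]) = AO.map (IsLocalRing.residue 𝒪[K]) * Matrix.diagonal y * AO'.map (IsLocalRing.residue 𝒪[K]) := by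
    rw [hY₀def, Matrix.map_mul, Matrix.map_mul, Matrix.diagonal_map (map_zero _)]
  have hY : ((Ab⁻¹ : GL (Fin 3) 𝓀[K]) : Matrix (Fin 3) (Fin 3) 𝓀[K]) * Y₀.map (IsLocalRing.residue 𝒪[K]) * (Ab : Matrix (Fin 3) (Fin 3) 𝓀[K]) = Matrix.diagonal y := by
    rw [hYbar, ← hAb, ← hAb', ← Matrix.mul_assoc, ← Matrix.mul_assoc, hAb2, Matrix.one_mul, Matrix.mul_assoc, hAb2, Matrix.mul_one]
  -- ### the eigenvalue residues: close pair equal, isolated one different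
  have hyeq : ∀ j l, j ≠ i₀ → l ≠ i₀ → y j = y l := fun j l hj hl => by
    refine residue_eq_of_v_sub_lt_one ?_
    change Valued.v ((ϖ ^ d₀)⁻¹ * (s j - 1) - (ϖ ^ d₀)⁻¹ * (s l - 1)) < 1
    rw [show (ϖ ^ d₀)⁻¹ * (s j - 1) - (ϖ ^ d₀)⁻¹ * (s l - 1) = (ϖ ^ d₀)⁻¹ * (s j - s l) by ring, map_mul, map_inv₀, map_pow]
    have h' := mul_le_mul' (le_refl ((Valued.v ϖ ^ d₀)⁻¹)) (hclose j l hj hl)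
    rw [pow_add, ← mul_assoc, inv_mul_cancel₀ hvd0, one_mul] at h'
    calc (Valued.v ϖ ^ d₀)⁻¹ * Valued.v (s j - s l) ≤ Valued.v ϖ ^ 2 := h'
      _ < 1 := by
        rw [pow_two]
        calc Valued.v ϖ * Valued.v ϖ ≤ 1 * Valued.v ϖ := mul_le_mul' hϖlt1.le le_rfl
          _ = Valued.v ϖ := one_mul _
          _ < 1 := hϖlt1
  have hyne : ∀ j, j ≠ i₀ → y i₀ ≠ y j := fun j hj h => by
    have h0 : IsLocalRing.residue 𝒪[K] (tO i₀ - tO j) = 0 := by rw [map_sub, sub_eq_zero]; exact h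
    rw [hres0] at h0
    have hval : Valued.v (((tO i₀ - tO j : 𝒪[K]) : K)) = 1 := by
      change Valued.v ((ϖ ^ d₀)⁻¹ * (s i₀ - 1) - (ϖ ^ d₀)⁻¹ * (s j - 1)) = 1
      rw [show (ϖ ^ d₀)⁻¹ * (s i₀ - 1) - (ϖ ^ d₀)⁻¹ * (s j - 1) = (ϖ ^ d₀)⁻¹ * (s i₀ - s j) by ring, map_mul, map_inv₀, map_pow, hiso j hj,
        inv_mul_cancel₀ hvd0]
    exact (lt_irrefl _) (hval ▸ h0)
  -- ### the root-plane dictionary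
  have hdict : ∀ j l, j ≠ i₀ → l ≠ i₀ → j ≠ l →
      ((∃ t : K, Valued.v t = 1 ∧ Valued.v (d j + t * σ t * d l) < 1) ↔ quadraticChar 𝓀[K] (-(δ j * δ l)) = 1) := by
    intro j l _ _ _
    have hδjl : -(δ j * δ l) = cb⁻¹ * cb⁻¹ * -(IsLocalRing.residue 𝒪[K] (dO j) * IsLocalRing.residue 𝒪[K] (dO l)) := by
      simp only [hδ]; ring
    rw [quadraticChar_one_iff_isSquare (neg_ne_zero.2 (mul_ne_zero (hδ0 j) (hδ0 l))), hδjl, isSquare_mul_self_mul_iff' (inv_ne_zero hcb0)]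
    constructor
    · rintro ⟨z, hz1, hz⟩
      -- residually `d̄_j + z̄² d̄_l = 0`, so `−d̄_j d̄_l = (z̄ d̄_l)²`
      set zO : 𝒪[K] := ⟨z, (Valuation.mem_integer_iff _ _).2 hz1.le⟩ with hzO
      have hzσ : IsLocalRing.residue 𝒪[K] ⟨σ ((zO : 𝒪[K]) : K), map_coe_mem_integer hvσ zO⟩ = IsLocalRing.residue 𝒪[K] zO :=
        residue_map_sigma_eq hvσ hres zO
      have hsum : IsLocalRing.residue 𝒪[K] (dO j + zO * ⟨σ ((zO : 𝒪[K]) : K), map_coe_mem_integer hvσ zO⟩ * dO l) = 0 := by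
        rw [hres0]; exact hz
      rw [map_add, map_mul, map_mul, hzσ] at hsum
      refine ⟨IsLocalRing.residue 𝒪[K] zO * IsLocalRing.residue 𝒪[K] (dO l), ?_⟩
      linear_combination (-(IsLocalRing.residue 𝒪[K] (dO l))) * hsum
    · rintro ⟨w, hw⟩
      -- lift `z̄ := w ∕ d̄_l`
      obtain ⟨zO, hzO⟩ := IsLocalRing.residue_surjective (w / IsLocalRing.residue 𝒪[K] (dO l))
      have hw0 : w ≠ 0 := fun h0 => by
        rw [h0, mul_zero, neg_eq_zero] at hw
        exact mul_ne_zero (hdres0 j) (hdres0 l) hw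
      have hzv : Valued.v (zO : K) = 1 := by
        refine le_antisymm zO.2 (not_lt.1 fun hlt => ?_)
        have h0 : IsLocalRing.residue 𝒪[K] zO = 0 := (hres0 zO).2 hlt
        rw [hzO, div_eq_zero_iff] at h0
        exact h0.elim hw0 (hdres0 l)
      refine ⟨(zO : K), hzv, ?_⟩
      have hzσ : IsLocalRing.residue 𝒪[K] ⟨σ ((zO : 𝒪[K]) : K), map_coe_mem_integer hvσ zO⟩ = IsLocalRing.residue 𝒪[K] zO :=
        residue_map_sigma_eq hvσ hres zO
      have hsum : IsLocalRing.residue 𝒪[K] (dO j + zO * ⟨σ ((zO : 𝒪[K]) : K), map_coe_mem_integer hvσ zO⟩ * dO l) = 0 := by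
        have hl0 := hdres0 l
        rw [map_add, map_mul, map_mul, hzσ, hzO,
          show w / IsLocalRing.residue 𝒪[K] (dO l) * (w / IsLocalRing.residue 𝒪[K] (dO l)) * IsLocalRing.residue 𝒪[K] (dO l) =
            w * w / IsLocalRing.residue 𝒪[K] (dO l) by field_simp,
          ← hw, neg_div, mul_div_cancel_right₀ _ hl0, add_neg_cancel]
      rw [hres0] at hsum
      exact hsum
  exact ⟨Ab, Y₀, δ, y, hY₀, hG, hδ0, hY, hyeq, hyne, hdict⟩

/-! ## §3 (ED. 2) The same package with the frame data pinned -/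

/-- **THE RESIDUAL EIGENFRAME, ED. 2 — with the frame data PINNED** (same statement plus two conjuncts naming `δ_m = red(d_m∕(−det diag d))` and
`y_m = red((s_m − 1)∕ϖ^{d₀})`, so a consumer can identify the census class `(y_{i₀} − y_j)·δ_{i₀}` with the residue of its own `K`-level constant).  For the junction's eigen-data — `A ∈ GL₃(K)` integral with integral inverse, `diag(d) = (−det diag d)·ᵗσ(A)·J₀·A`
with unit `d`, `γ = A·diag(s)·A⁻¹`, `|s_m − 1| ≤ |ϖ|^{d₀}`, isolated index `i₀` (`|s_{i₀} − s_j| = |ϖ|^{d₀}` for `j ≠ i₀`), close pair `|s_j − s_l| ≤ |ϖ|^{d₀+2}` — there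
are `Ā ∈ GL₃(𝓀)`, an integral `Y₀ = (ϖ^{d₀})⁻¹(γ − 1)`, and `δ, y : Fin 3 → 𝓀` with: `ᵗĀ·J̄₀·Ā = diag(δ)`, all `δ_m ≠ 0`; `Ā⁻¹·Ȳ·Ā = diag(y)` (`Ȳ = Y₀ mod ϖ`); `y_j = y_l` on
the close pair and `y_{i₀} ≠ y_j`; and the ROOT-PLANE DICTIONARY `(∃ t, |t| = 1 ∧ |d_j + tσ(t)d_l| < 1) ↔ χ(−δ_jδ_l) = 1` (F0P3-p03's ★ token p847753).  (`σ` valuation-preserving and residually trivial.)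
[cite: Kottwitz1986, §3] [cite: BruhatTits1972, §10] [cite: Rogawski1990, §4.9 p. 55] -/
theorem exists_residualEigenframe_of_isoceles' (hvσ : ∀ a, Valued.v (σ a) = Valued.v a) (hres : ∀ x : K, Valued.v x ≤ 1 → Valued.v (σ x - x) < 1)
    (hϖ : Valued.v ϖ = WithZero.exp (-1 : ℤ)) [Fintype 𝓀[K]] [DecidableEq 𝓀[K]]
    {γ : unitaryGroupOfForm σ ((StdForm.antidiagonal 3).over K)}
    (d : Fin 3 → K) (hd : ∀ i, Valued.v (d i) = 1)
    (A : GL (Fin 3) K) (hA : IsIntMatrix (A : Matrix (Fin 3) (Fin 3) K)) (hA' : IsIntMatrix ((A⁻¹ : GL (Fin 3) K) : Matrix (Fin 3) (Fin 3) K))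
    (hdA : Matrix.diagonal d = (-(Matrix.diagonal d).det) • formCongr σ A ((StdForm.antidiagonal 3).over K))
    (s : Fin 3 → K)
    (hγA : ((γ : GL (Fin 3) K) : Matrix (Fin 3) (Fin 3) K) = (A : Matrix (Fin 3) (Fin 3) K) * Matrix.diagonal s * ((A⁻¹ : GL (Fin 3) K) : Matrix (Fin 3) (Fin 3) K))
    (i₀ : Fin 3) {d₀ : ℕ} (he : ∀ i, Valued.v (s i - 1) ≤ Valued.v ϖ ^ d₀)
    (hiso : ∀ j, j ≠ i₀ → Valued.v (s i₀ - s j) = Valued.v ϖ ^ d₀) (hclose : ∀ j k, j ≠ i₀ → k ≠ i₀ → Valued.v (s j - s k) ≤ Valued.v ϖ ^ (d₀ + 2)) :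
    ∃ (Ab : GL (Fin 3) 𝓀[K]) (Y₀ : Matrix (Fin 3) (Fin 3) 𝒪[K]) (δ y : Fin 3 → 𝓀[K]),
      (∀ i j, ((Y₀ i j : 𝒪[K]) : K) = (ϖ ^ d₀)⁻¹ * ((((γ : GL (Fin 3) K) : Matrix (Fin 3) (Fin 3) K) - 1) i j)) ∧
      ((Ab : Matrix (Fin 3) (Fin 3) 𝓀[K]))ᵀ * ((StdForm.antidiagonal 3).over 𝓀[K]) * (Ab : Matrix (Fin 3) (Fin 3) 𝓀[K]) = Matrix.diagonal δ ∧
      (∀ m, δ m ≠ 0) ∧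
      ((Ab⁻¹ : GL (Fin 3) 𝓀[K]) : Matrix (Fin 3) (Fin 3) 𝓀[K]) * Y₀.map (IsLocalRing.residue 𝒪[K]) * (Ab : Matrix (Fin 3) (Fin 3) 𝓀[K]) = Matrix.diagonal y ∧
      (∀ j l, j ≠ i₀ → l ≠ i₀ → y j = y l) ∧ (∀ j, j ≠ i₀ → y i₀ ≠ y j) ∧
      (∀ j l, j ≠ i₀ → l ≠ i₀ → j ≠ l →
        ((∃ t : K, Valued.v t = 1 ∧ Valued.v (d j + t * σ t * d l) < 1) ↔ quadraticChar 𝓀[K] (-(δ j * δ l)) = 1)) ∧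
      (∀ m (z : 𝒪[K]), (z : K) = d m * (-(Matrix.diagonal d).det)⁻¹ → δ m = IsLocalRing.residue 𝒪[K] z) ∧
      (∀ m (z : 𝒪[K]), (z : K) = (ϖ ^ d₀)⁻¹ * (s m - 1) → y m = IsLocalRing.residue 𝒪[K] z) := by
  have hϖ0 : ϖ ≠ 0 := uniformizer_ne_zero hϖ
  have hvϖ0 : Valued.v ϖ ≠ 0 := (Valuation.ne_zero_iff _).2 hϖ0
  have hvd0 : Valued.v ϖ ^ d₀ ≠ 0 := pow_ne_zero _ hvϖ0
  have hlt1 : ∀ z : K, Valued.v z < 1 ↔ Valued.v z ≤ Valued.v ϖ := fun z => by rw [hϖ]; exact v_lt_one_iff z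
  have hϖlt1 : Valued.v ϖ < 1 := (hlt1 ϖ).2 le_rfl
  have hres0 : ∀ x : 𝒪[K], IsLocalRing.residue 𝒪[K] x = 0 ↔ Valued.v (x : K) < 1 := residue_eq_zero_iff_v_lt_one
  obtain ⟨AO, AO', Ab, hmA, hmA', h1, h2, hAb, hAb'⟩ := exists_residualGL_of_isIntMatrix A hA hA'
  have hinj : Function.Injective (fun M : Matrix (Fin 3) (Fin 3) 𝒪[K] => M.map (Valued.integer K).subtype) :=
    Matrix.map_injective Subtype.coe_injective
  -- residual inverse pair
  have hAb1 : (Ab : Matrix (Fin 3) (Fin 3) 𝓀[K]) * ((Ab⁻¹ : GL (Fin 3) 𝓀[K]) : Matrix (Fin 3) (Fin 3) 𝓀[K]) = 1 := by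
    rw [← Units.val_mul, mul_inv_cancel, Units.val_one]
  have hAb2 : ((Ab⁻¹ : GL (Fin 3) 𝓀[K]) : Matrix (Fin 3) (Fin 3) 𝓀[K]) * (Ab : Matrix (Fin 3) (Fin 3) 𝓀[K]) = 1 := by
    rw [← Units.val_mul, inv_mul_cancel, Units.val_one]
  -- ### the integral eigenvalue leading terms `t m = (ϖ^{d₀})⁻¹ (s m − 1)`
  have ht : ∀ m, (ϖ ^ d₀)⁻¹ * (s m - 1) ∈ 𝒪[K] := fun m => by
    refine (Valuation.mem_integer_iff _ _).2 ?_
    rw [map_mul, map_inv₀, map_pow]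
    have h' := mul_le_mul' (le_refl ((Valued.v ϖ ^ d₀)⁻¹)) (he m)
    rwa [inv_mul_cancel₀ hvd0] at h'
  set tO : Fin 3 → 𝒪[K] := fun m => ⟨(ϖ ^ d₀)⁻¹ * (s m - 1), ht m⟩ with htO
  set Y₀ : Matrix (Fin 3) (Fin 3) 𝒪[K] := AO * Matrix.diagonal tO * AO' with hY₀def
  have hAA : (A : Matrix (Fin 3) (Fin 3) K) * ((A⁻¹ : GL (Fin 3) K) : Matrix (Fin 3) (Fin 3) K) = 1 := by
    rw [← Units.val_mul, mul_inv_cancel, Units.val_one]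
  have hY₀map : Y₀.map (Valued.integer K).subtype = (ϖ ^ d₀)⁻¹ • ((((γ : GL (Fin 3) K) : Matrix (Fin 3) (Fin 3) K) - 1)) := by
    rw [hY₀def, Matrix.map_mul, Matrix.map_mul, hmA, hmA', Matrix.diagonal_map (map_zero _)]
    have hdiag : Matrix.diagonal (fun m => (Valued.integer K).subtype (tO m)) = (ϖ ^ d₀)⁻¹ • Matrix.diagonal (s - 1) := by
      rw [← Matrix.diagonal_smul]; rfl
    have hds : Matrix.diagonal (s - 1) = Matrix.diagonal s - 1 := by
      rw [← Matrix.diagonal_one, Matrix.diagonal_sub]; rfl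
    rw [hdiag, Matrix.mul_smul, Matrix.smul_mul, hγA, hds, Matrix.mul_sub, Matrix.sub_mul, Matrix.mul_one, hAA]
  have hY₀ : ∀ i j, ((Y₀ i j : 𝒪[K]) : K) = (ϖ ^ d₀)⁻¹ * ((((γ : GL (Fin 3) K) : Matrix (Fin 3) (Fin 3) K) - 1) i j) := fun i j => by
    have h := congrFun (congrFun hY₀map i) j
    rw [Matrix.map_apply, Matrix.smul_apply, smul_eq_mul] at h
    exact h
  -- ### the residual Gram: `diag(d) = c • ᵗσ(A) J₀ A` integrally, then mod ϖ with `σ̄ = id`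
  set c : K := -(Matrix.diagonal d).det with hc
  have hcv : Valued.v c = 1 := by
    rw [hc, Valuation.map_neg, Matrix.det_diagonal, map_prod]
    exact Finset.prod_eq_one fun i _ => hd i
  have hcO : c ∈ 𝒪[K] := (Valuation.mem_integer_iff _ _).2 hcv.le
  set AσO : Matrix (Fin 3) (Fin 3) 𝒪[K] := Matrix.of fun i j => (⟨σ ((AO i j : 𝒪[K]) : K), map_coe_mem_integer hvσ (AO i j)⟩ : 𝒪[K]) with hAσO
  have hmAσ : AσO.map (Valued.integer K).subtype = ((A : Matrix (Fin 3) (Fin 3) K)).map σ := by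
    ext i j
    rw [← hmA]
    rfl
  set dO : Fin 3 → 𝒪[K] := fun m => ⟨d m, (Valuation.mem_integer_iff _ _).2 (hd m).le⟩ with hdO
  -- the integral identity `diag(dO) = diag(c) * (ᵗAσO * J₀O * AO)`
  have hint : Matrix.diagonal dO = Matrix.diagonal (fun _ => (⟨c, hcO⟩ : 𝒪[K])) * ((AσO)ᵀ * ((StdForm.antidiagonal 3).over 𝒪[K]) * AO) := hinj (by
    dsimp only
    rw [Matrix.map_mul, Matrix.map_mul, Matrix.map_mul, Matrix.diagonal_map (map_zero _), Matrix.diagonal_map (map_zero _), Matrix.transpose_map, hmAσ, hmA,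
      StdForm.over_map', ← Matrix.smul_eq_diagonal_mul]
    exact hdA)
  -- mod ϖ: `σ̄ = id` on residues
  have hAσres : AσO.map (IsLocalRing.residue 𝒪[K]) = AO.map (IsLocalRing.residue 𝒪[K]) := by
    ext i j
    rw [Matrix.map_apply, Matrix.map_apply, hAσO, Matrix.of_apply]
    exact residue_map_sigma_eq hvσ hres (AO i j)
  set cb : 𝓀[K] := IsLocalRing.residue 𝒪[K] ⟨c, hcO⟩ with hcb
  have hcb0 : cb ≠ 0 := by
    rw [hcb, Ne, hres0]; exact fun h => absurd hcv (ne_of_lt h)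
  set δ : Fin 3 → 𝓀[K] := fun m => cb⁻¹ * IsLocalRing.residue 𝒪[K] (dO m) with hδ
  have hdres0 : ∀ m, IsLocalRing.residue 𝒪[K] (dO m) ≠ 0 := fun m => by
    rw [Ne, hres0]; exact fun h => absurd (hd m) (ne_of_lt h)
  have hδ0 : ∀ m, δ m ≠ 0 := fun m => mul_ne_zero (inv_ne_zero hcb0) (hdres0 m)
  have hres' : Matrix.diagonal (fun m => IsLocalRing.residue 𝒪[K] (dO m)) =
      Matrix.diagonal (fun _ : Fin 3 => cb) * ((AO.map (IsLocalRing.residue 𝒪[K]))ᵀ * ((StdForm.antidiagonal 3).over 𝓀[K]) * AO.map (IsLocalRing.residue 𝒪[K])) := by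
    have h := congrArg (fun M : Matrix (Fin 3) (Fin 3) 𝒪[K] => M.map (IsLocalRing.residue 𝒪[K])) hint
    simpa only [Matrix.map_mul, Matrix.diagonal_map (map_zero _), Matrix.transpose_map, hAσres, StdForm.over_map'] using h
  have hG : ((Ab : Matrix (Fin 3) (Fin 3) 𝓀[K]))ᵀ * ((StdForm.antidiagonal 3).over 𝓀[K]) * (Ab : Matrix (Fin 3) (Fin 3) 𝓀[K]) = Matrix.diagonal δ := by
    have hone : Matrix.diagonal (fun _ : Fin 3 => cb⁻¹) * Matrix.diagonal (fun _ : Fin 3 => cb) = 1 := by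
      rw [Matrix.diagonal_mul_diagonal, ← Matrix.diagonal_one]
      exact congrArg Matrix.diagonal (funext fun _ => inv_mul_cancel₀ hcb0)
    rw [hAb]
    calc (AO.map (IsLocalRing.residue 𝒪[K]))ᵀ * ((StdForm.antidiagonal 3).over 𝓀[K]) * AO.map (IsLocalRing.residue 𝒪[K])
        = Matrix.diagonal (fun _ : Fin 3 => cb⁻¹) * (Matrix.diagonal (fun _ : Fin 3 => cb) *
            ((AO.map (IsLocalRing.residue 𝒪[K]))ᵀ * ((StdForm.antidiagonal 3).over 𝓀[K]) * AO.map (IsLocalRing.residue 𝒪[K]))) := by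
          rw [← Matrix.mul_assoc, hone, Matrix.one_mul]
      _ = Matrix.diagonal (fun _ : Fin 3 => cb⁻¹) * Matrix.diagonal (fun m => IsLocalRing.residue 𝒪[K] (dO m)) := by rw [← hres']
      _ = Matrix.diagonal δ := by rw [Matrix.diagonal_mul_diagonal]
  -- ### `Ȳ = Ā diag(ȳ) Ā'`
  set y : Fin 3 → 𝓀[K] := fun m => IsLocalRing.residue 𝒪[K] (tO m) with hy
  have hYbar : Y₀.map (IsLocalRing.residue 𝒪[K]) = AO.map (IsLocalRing.residue 𝒪[K]) * Matrix.diagonal y * AO'.map (IsLocalRing.residue 𝒪[K]) := by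
    rw [hY₀def, Matrix.map_mul, Matrix.map_mul, Matrix.diagonal_map (map_zero _)]
  have hY : ((Ab⁻¹ : GL (Fin 3) 𝓀[K]) : Matrix (Fin 3) (Fin 3) 𝓀[K]) * Y₀.map (IsLocalRing.residue 𝒪[K]) * (Ab : Matrix (Fin 3) (Fin 3) 𝓀[K]) = Matrix.diagonal y := by
    rw [hYbar, ← hAb, ← hAb', ← Matrix.mul_assoc, ← Matrix.mul_assoc, hAb2, Matrix.one_mul, Matrix.mul_assoc, hAb2, Matrix.mul_one]
  -- ### the eigenvalue residues: close pair equal, isolated one different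
  have hyeq : ∀ j l, j ≠ i₀ → l ≠ i₀ → y j = y l := fun j l hj hl => by
    refine residue_eq_of_v_sub_lt_one ?_
    change Valued.v ((ϖ ^ d₀)⁻¹ * (s j - 1) - (ϖ ^ d₀)⁻¹ * (s l - 1)) < 1
    rw [show (ϖ ^ d₀)⁻¹ * (s j - 1) - (ϖ ^ d₀)⁻¹ * (s l - 1) = (ϖ ^ d₀)⁻¹ * (s j - s l) by ring, map_mul, map_inv₀, map_pow]
    have h' := mul_le_mul' (le_refl ((Valued.v ϖ ^ d₀)⁻¹)) (hclose j l hj hl)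
    rw [pow_add, ← mul_assoc, inv_mul_cancel₀ hvd0, one_mul] at h'
    calc (Valued.v ϖ ^ d₀)⁻¹ * Valued.v (s j - s l) ≤ Valued.v ϖ ^ 2 := h'
      _ < 1 := by
        rw [pow_two]
        calc Valued.v ϖ * Valued.v ϖ ≤ 1 * Valued.v ϖ := mul_le_mul' hϖlt1.le le_rfl
          _ = Valued.v ϖ := one_mul _
          _ < 1 := hϖlt1
  have hyne : ∀ j, j ≠ i₀ → y i₀ ≠ y j := fun j hj h => by
    have h0 : IsLocalRing.residue 𝒪[K] (tO i₀ - tO j) = 0 := by rw [map_sub, sub_eq_zero]; exact h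
    rw [hres0] at h0
    have hval : Valued.v (((tO i₀ - tO j : 𝒪[K]) : K)) = 1 := by
      change Valued.v ((ϖ ^ d₀)⁻¹ * (s i₀ - 1) - (ϖ ^ d₀)⁻¹ * (s j - 1)) = 1
      rw [show (ϖ ^ d₀)⁻¹ * (s i₀ - 1) - (ϖ ^ d₀)⁻¹ * (s j - 1) = (ϖ ^ d₀)⁻¹ * (s i₀ - s j) by ring, map_mul, map_inv₀, map_pow, hiso j hj,
        inv_mul_cancel₀ hvd0]
    exact (lt_irrefl _) (hval ▸ h0)
  -- ### the root-plane dictionary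
  have hdict : ∀ j l, j ≠ i₀ → l ≠ i₀ → j ≠ l →
      ((∃ t : K, Valued.v t = 1 ∧ Valued.v (d j + t * σ t * d l) < 1) ↔ quadraticChar 𝓀[K] (-(δ j * δ l)) = 1) := by
    intro j l _ _ _
    have hδjl : -(δ j * δ l) = cb⁻¹ * cb⁻¹ * -(IsLocalRing.residue 𝒪[K] (dO j) * IsLocalRing.residue 𝒪[K] (dO l)) := by
      simp only [hδ]; ring
    rw [quadraticChar_one_iff_isSquare (neg_ne_zero.2 (mul_ne_zero (hδ0 j) (hδ0 l))), hδjl, isSquare_mul_self_mul_iff' (inv_ne_zero hcb0)]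
    constructor
    · rintro ⟨z, hz1, hz⟩
      -- residually `d̄_j + z̄² d̄_l = 0`, so `−d̄_j d̄_l = (z̄ d̄_l)²`
      set zO : 𝒪[K] := ⟨z, (Valuation.mem_integer_iff _ _).2 hz1.le⟩ with hzO
      have hzσ : IsLocalRing.residue 𝒪[K] ⟨σ ((zO : 𝒪[K]) : K), map_coe_mem_integer hvσ zO⟩ = IsLocalRing.residue 𝒪[K] zO :=
        residue_map_sigma_eq hvσ hres zO
      have hsum : IsLocalRing.residue 𝒪[K] (dO j + zO * ⟨σ ((zO : 𝒪[K]) : K), map_coe_mem_integer hvσ zO⟩ * dO l) = 0 := by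
        rw [hres0]; exact hz
      rw [map_add, map_mul, map_mul, hzσ] at hsum
      refine ⟨IsLocalRing.residue 𝒪[K] zO * IsLocalRing.residue 𝒪[K] (dO l), ?_⟩
      linear_combination (-(IsLocalRing.residue 𝒪[K] (dO l))) * hsum
    · rintro ⟨w, hw⟩
      -- lift `z̄ := w ∕ d̄_l`
      obtain ⟨zO, hzO⟩ := IsLocalRing.residue_surjective (w / IsLocalRing.residue 𝒪[K] (dO l))
      have hw0 : w ≠ 0 := fun h0 => by
        rw [h0, mul_zero, neg_eq_zero] at hw
        exact mul_ne_zero (hdres0 j) (hdres0 l) hw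
      have hzv : Valued.v (zO : K) = 1 := by
        refine le_antisymm zO.2 (not_lt.1 fun hlt => ?_)
        have h0 : IsLocalRing.residue 𝒪[K] zO = 0 := (hres0 zO).2 hlt
        rw [hzO, div_eq_zero_iff] at h0
        exact h0.elim hw0 (hdres0 l)
      refine ⟨(zO : K), hzv, ?_⟩
      have hzσ : IsLocalRing.residue 𝒪[K] ⟨σ ((zO : 𝒪[K]) : K), map_coe_mem_integer hvσ zO⟩ = IsLocalRing.residue 𝒪[K] zO :=
        residue_map_sigma_eq hvσ hres zO
      have hsum : IsLocalRing.residue 𝒪[K] (dO j + zO * ⟨σ ((zO : 𝒪[K]) : K), map_coe_mem_integer hvσ zO⟩ * dO l) = 0 := by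
        have hl0 := hdres0 l
        rw [map_add, map_mul, map_mul, hzσ, hzO,
          show w / IsLocalRing.residue 𝒪[K] (dO l) * (w / IsLocalRing.residue 𝒪[K] (dO l)) * IsLocalRing.residue 𝒪[K] (dO l) =
            w * w / IsLocalRing.residue 𝒪[K] (dO l) by field_simp,
          ← hw, neg_div, mul_div_cancel_right₀ _ hl0, add_neg_cancel]
      rw [hres0] at hsum
      exact hsum
  -- ### pinning the frame data
  have hδpin : ∀ m (z : 𝒪[K]), (z : K) = d m * (-(Matrix.diagonal d).det)⁻¹ → δ m = IsLocalRing.residue 𝒪[K] z := by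
    intro m z hz
    have hc0 : c ≠ 0 := fun h0 => by rw [h0, map_zero] at hcv; exact zero_ne_one hcv
    have hzc : z * ⟨c, hcO⟩ = dO m := Subtype.ext (by
      change (z : K) * c = d m
      rw [hz, ← hc, mul_assoc, inv_mul_cancel₀ hc0, mul_one])
    have hres := congrArg (IsLocalRing.residue 𝒪[K]) hzc
    rw [map_mul] at hres
    change cb⁻¹ * IsLocalRing.residue 𝒪[K] (dO m) = IsLocalRing.residue 𝒪[K] z
    rw [← hres, ← hcb, mul_comm (IsLocalRing.residue 𝒪[K] z) cb, ← mul_assoc, inv_mul_cancel₀ hcb0, one_mul]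
  have hypin : ∀ m (z : 𝒪[K]), (z : K) = (ϖ ^ d₀)⁻¹ * (s m - 1) → y m = IsLocalRing.residue 𝒪[K] z := by
    intro m z hz
    have hzt : z = tO m := Subtype.ext hz
    rw [hzt]
  exact ⟨Ab, Y₀, δ, y, hY₀, hG, hδ0, hY, hyeq, hyne, hdict, hδpin, hypin⟩

end Literature.NumberTheory.Automorphic.UnitaryLatticeTree

end
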